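import Mathlib
import HarnessLib
import Summits.RiemannHypothesis.RiemannHypothesis.Theses.TuranResolution
import Literature.Analysis.Complex.LogTaylorContinuation
import Literature.NumberTheory.LFunctions.ZetaLogDerivDisc
import Literature.NumberTheory.LFunctions.GeneralizedRH
import Literature.NumberTheory.DiophantineGeometry.NamedHypothesesRHProofs

/-!
# STRATEGY CENSUS (typed sheet) — crux `TuranResolution.TuranCriterion` (stmt-RiemannHypothesis-2529)

crux-strategist planner-cstrat-stmt-RiemannHypothesis-2529-r1-0, 2026-08-17 (RESTATED re-audit, BC2-redirect test).
Companion of `STRATEGY-CENSUS.md` in this directory. SORRY-FREE; `lean check` rc 0, 0 warnings; axioms of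
every theorem ⊆ {propext, Classical.choice, Quot.sound}.

Contents
* `turanCoeff t k` = the crux's inlined tangent-disc power sum `Z_k(t)`; `turanCriterion_iff` (definitional).
* §R  restriction pieces `Restrict q R` and the generic (trivial-seam) assembly `turanCriterion_of_cover`;
      instances: `Head`/`Tail` (cut-off in `k`), `Low`/`High` (height), `OddK`/`EvenK` (parity) + their assemblies.
* §L  the rate ladder `Rate r` (`rate_three_halves_iff : Rate (3/2) ↔ TuranCriterion`, `Rate.anti`), bridge
      pieces `RateBridge r`, assembly `turanCriterion_of_rate_bridge` (modus ponens).
* §C  COSTUME LEMMA L1 (kernel-checked): `riemannZeta₁_ne_zero_of_tail` — at ONE height `t`, a geometric bound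
      `‖Z_k(t)‖ ≤ C r⁻ᵏ log(|t|+3)` for the LARGE `k > K` alone forces `ζ₁ ≠ 0` on the open disc `B(2+it, r)`
      (engine: the tree's `Literature.Analysis.Complex.ne_zero_of_taylor_bound` on `Z_t(w) = ζ₁(2+it+w)/ζ₁(2+it)`,
      whose log-Taylor coefficients are `a_{k+1} = (-1)^k k!/(k+1)! · (Z_k(t) + T_k(t))`, `T_k` the trivial-zero sum).
      Consequences: `quasiRH_of_rateTail`, `quasiRH_of_rate : Rate r → QuasiRiemannHypothesis (2 - r)`,
      `riemannHypothesis_of_tail : Tail K → RiemannHypothesis` for EVERY `K : ℝ → ℕ`,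
      `riemannHypothesis_of_turanCriterion : TuranCriterion → RiemannHypothesis` (the route's unlanded X → RH,
      WITHOUT `LocalDetection`), `tail_iff_of_criterionOfRH : CriterionOfRH → (Tail K ↔ TuranCriterion)`,
      `no_offLine_zero_of_high`, `riemannHypothesis_of_high_of_upTo : High T₀ → RiemannHypothesisUpTo T₀ → RH`,
      `riemannHypothesis_of_limsupShadow` (the pointwise-qualitative shadow `limsup |Z_k(t)|^{1/k} ≤ 2/3` is RH).
* §C' COSTUME LEMMA L2 (parity, kernel-checked): `riemannZeta₁_ne_zero_of_oddTail`, `riemannHypothesis_of_oddTail`,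
      `riemannHypothesis_of_oddK : OddK → RiemannHypothesis` (even function `Z_t(w)Z_t(-w)`; Weil's even-power trick).
* §T  THE TRIVIAL REGIME IS A THEOREM (kernel-checked): `exists_norm_turanCoeff_le` (`‖Z_k(t)‖ ≤ M₀` for all `t`, `k ≥ 1`,
      via Mathlib's `LSeries_vonMangoldt_eq_deriv_riemannZeta_div`, `LSeries_iteratedDeriv`, positivity of the coefficients
      `log^k n · Λ(n)` and Cauchy's estimate for `ζ₁′/ζ₁` on `|s−2| ≤ 1`), `head_of_pow_le : (∀ t, (3/2)^{K t} ≤ B log(|t|+3)) → Head K`,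
      `turanCriterion_iff_tail_of_pow_le : … → (TuranCriterion ↔ Tail K)` — the `k`-split at `K ≈ 2.47 log log|t|` is
      `X ⟸ (theorem) ∧ (X)`.
* §I  the isolation / conditional-head split: `clusterCount`, `detectRange`, `IOZ`, `PolylogHead`, `CondHead`;
      `localDetection_iff` (definitional), `quasiRH_of_condHead : CondHead → LocalDetection → QuasiRH (1/2)`,
      `turanCriterion_of_condHead : CondHead → LocalDetection → CriterionOfRH → TuranCriterion`,
      `condHead_of_turanCriterion`, `polylogHead_of_turanCriterion`.
-/


noncomputable section

set_option linter.dupNamespace false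

namespace Summit.RiemannHypothesis.RiemannHypothesis.Cruxes.TuranCriterion.StrategyCensus

open Complex Filter Topology Set Metric
open scoped Nat
open Summit.RiemannHypothesis.RiemannHypothesis.Theses.TuranResolution
open Literature.NumberTheory.LFunctions

/-! ### The coefficient and the full criterion -/

/-- `Z_k(t)`: the crux's inlined tangent-disc power sum (ζ-side expression). -/
def turanCoeff (t : ℝ) (k : ℕ) : ℂ :=
  (-1 : ℂ) ^ k * iteratedDeriv k (logDeriv riemannZeta) (2 + t * Complex.I) / (k.factorial : ℂ)
    + ((1 + t * Complex.I) ^ (k + 1))⁻¹ - ∑' m : ℕ, ((4 + 2 * (m : ℂ) + t * Complex.I) ^ (k + 1))⁻¹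

/-- The threshold `C (2/3)^k log(|t|+3)` of the crux, with a general ratio `q` in place of `2/3`. -/
def thr (q C : ℝ) (t : ℝ) (k : ℕ) : ℝ := C * q ^ k * Real.log (|t| + 3)

theorem turanCriterion_iff :
    TuranCriterion ↔ ∃ C : ℝ, ∀ (t : ℝ) (k : ℕ), 1 ≤ k → ‖turanCoeff t k‖ ≤ thr (2 / 3) C t k :=
  Iff.rfl

/-! ### §R Restriction pieces and the generic assembly -/

/-- The crux's inequality demanded only on the instances `(t,k)` selected by `R` (ratio `q`). -/
def Restrict (q : ℝ) (R : ℝ → ℕ → Prop) : Prop :=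
  ∃ C : ℝ, ∀ (t : ℝ) (k : ℕ), 1 ≤ k → R t k → ‖turanCoeff t k‖ ≤ thr q C t k

theorem log_height_pos (t : ℝ) : 0 < Real.log (|t| + 3) :=
  Real.log_pos (by linarith [abs_nonneg t])

theorem thr_mono {q C C' : ℝ} (hq : 0 ≤ q) (h : C ≤ C') (t : ℝ) (k : ℕ) : thr q C t k ≤ thr q C' t k :=
  mul_le_mul_of_nonneg_right (mul_le_mul_of_nonneg_right h (pow_nonneg hq k)) (log_height_pos t).le

/-- Generic assembly (trivial seam): two restriction pieces whose index sets cover everything give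
the full criterion with ratio `q` — the constant is the max of the two constants. -/
theorem restrict_of_cover {q : ℝ} (hq : 0 ≤ q) {R₁ R₂ R : ℝ → ℕ → Prop}
    (hcov : ∀ t k, 1 ≤ k → R t k → R₁ t k ∨ R₂ t k) :
    Restrict q R₁ → Restrict q R₂ → Restrict q R := by
  rintro ⟨C₁, h₁⟩ ⟨C₂, h₂⟩
  refine ⟨max C₁ C₂, fun t k hk hR ↦ ?_⟩
  rcases hcov t k hk hR with h | h
  · exact (h₁ t k hk h).trans (thr_mono hq (le_max_left _ _) t k)
  · exact (h₂ t k hk h).trans (thr_mono hq (le_max_right _ _) t k)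

theorem Restrict.anti {q : ℝ} {R R' : ℝ → ℕ → Prop} (h : ∀ t k, R' t k → R t k) :
    Restrict q R → Restrict q R' := by
  rintro ⟨C, hC⟩
  exact ⟨C, fun t k hk hR ↦ hC t k hk (h t k hR)⟩

theorem turanCriterion_iff_restrict_univ : TuranCriterion ↔ Restrict (2 / 3) fun _ _ ↦ True := by
  rw [turanCriterion_iff]
  exact ⟨fun ⟨C, h⟩ ↦ ⟨C, fun t k hk _ ↦ h t k hk⟩, fun ⟨C, h⟩ ↦ ⟨C, fun t k hk ↦ h t k hk trivial⟩⟩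

theorem turanCriterion_of_cover {R₁ R₂ : ℝ → ℕ → Prop} (hcov : ∀ t k, 1 ≤ k → R₁ t k ∨ R₂ t k)
    (h₁ : Restrict (2 / 3) R₁) (h₂ : Restrict (2 / 3) R₂) : TuranCriterion :=
  turanCriterion_iff_restrict_univ.2
    (restrict_of_cover (by norm_num) (fun t k hk _ ↦ hcov t k hk) h₁ h₂)

theorem restrict_of_turanCriterion (R : ℝ → ℕ → Prop) (h : TuranCriterion) : Restrict (2 / 3) R :=
  (turanCriterion_iff_restrict_univ.1 h).anti fun _ _ _ ↦ trivial

/-! #### F-k: head / tail in the prime length `k` (cut-off `K t`, any function of the height) -/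

/-- HEAD piece: the crux for `k ≤ K t` only ("short prime sums", length `≤ e^{K(t)+O(√K)}`). -/
def Head (K : ℝ → ℕ) : Prop := Restrict (2 / 3) fun t k ↦ k ≤ K t

/-- TAIL piece: the crux for `k > K t` only. -/
def Tail (K : ℝ → ℕ) : Prop := Restrict (2 / 3) fun t k ↦ K t < k

theorem turanCriterion_of_head_tail (K : ℝ → ℕ) (h₁ : Head K) (h₂ : Tail K) : TuranCriterion :=
  turanCriterion_of_cover (fun t k _ ↦ le_or_gt k (K t)) h₁ h₂

/-! #### F-t: low / high in the height -/

/-- LOW piece: the crux at heights `|t| ≤ T₀` (≈ RH up to height `T₀ + 3/2`: numerically verified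
territory for `T₀ ≤ 3·10¹²`, Platt–Trudgian 2021 = named fact `platt_trudgian_numerical_rh`). -/
def Low (T₀ : ℝ) : Prop := Restrict (2 / 3) fun t _ ↦ |t| ≤ T₀

/-- HIGH piece: the crux at heights `|t| > T₀`. -/
def High (T₀ : ℝ) : Prop := Restrict (2 / 3) fun t _ ↦ T₀ < |t|

theorem turanCriterion_of_low_high (T₀ : ℝ) (h₁ : Low T₀) (h₂ : High T₀) : TuranCriterion :=
  turanCriterion_of_cover (fun t _ _ ↦ le_or_gt |t| T₀) h₁ h₂

/-! #### F-p: parity of `k` (even / odd exponents `k+1`) -/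

/-- ODD-`k` piece (even exponents `k+1`: the `u ↦ u²`-generating function, Weil's "even `k`" trick). -/
def OddK : Prop := Restrict (2 / 3) fun _ k ↦ Odd k

/-- EVEN-`k` piece (odd exponents). -/
def EvenK : Prop := Restrict (2 / 3) fun _ k ↦ Even k

theorem turanCriterion_of_odd_even (h₁ : OddK) (h₂ : EvenK) : TuranCriterion :=
  turanCriterion_of_cover (fun _ k _ ↦ (Nat.even_or_odd k).symm) h₁ h₂

/-! ### §L The rate ladder `X_r` (`1 < r ≤ 3/2`): zero-free half-planes `Re s > 2 - r` -/

/-- `X_r`: the crux with the ratio `r⁻¹` in place of `2/3 = (3/2)⁻¹`. `Rate (3/2) = TuranCriterion`;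
`Rate r` for `1 < r < 3/2` is (at least) the quasi-Riemann hypothesis `ζ ≠ 0` on `Re s > 2 - r`
(`quasiRH_of_rate` below); `Rate 1` is unconditional in substance (all zeros have `Re ρ < 1`). -/
def Rate (r : ℝ) : Prop := Restrict r⁻¹ fun _ _ ↦ True

theorem rate_three_halves_iff : Rate (3 / 2) ↔ TuranCriterion := by
  rw [turanCriterion_iff_restrict_univ, Rate, show ((3 : ℝ) / 2)⁻¹ = 2 / 3 by norm_num]

/-- The ladder is monotone: a larger radius is a stronger statement. -/
theorem Rate.anti {r r' : ℝ} (hr : 0 < r) (hrr' : r ≤ r') : Rate r' → Rate r := by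
  rintro ⟨C, hC⟩
  refine ⟨max C 0, fun t k hk _ ↦ (hC t k hk trivial).trans ?_⟩
  unfold thr
  have hq : (r'⁻¹ : ℝ) ^ k ≤ r⁻¹ ^ k :=
    pow_le_pow_left₀ (inv_nonneg.2 (hr.le.trans hrr')) ((inv_le_inv₀ (hr.trans_le hrr') hr).2 hrr') k
  have hL := (log_height_pos t).le
  calc C * r'⁻¹ ^ k * Real.log (|t| + 3) ≤ max C 0 * r'⁻¹ ^ k * Real.log (|t| + 3) :=
        mul_le_mul_of_nonneg_right (mul_le_mul_of_nonneg_right (le_max_left _ _)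
          (pow_nonneg (inv_nonneg.2 (hr.le.trans hrr')) k)) hL
    _ ≤ max C 0 * r⁻¹ ^ k * Real.log (|t| + 3) :=
        mul_le_mul_of_nonneg_right (mul_le_mul_of_nonneg_left hq (le_max_right _ _)) hL

/-- BRIDGE piece of the ladder split `X ⟸ X_r ∧ (X_r → X)` ("quasi-RH at `2 - r` ⟹ RH"). -/
def RateBridge (r : ℝ) : Prop := Rate r → TuranCriterion

/-- The ladder split's assembly is modus ponens (`trivial_seam`). -/
theorem turanCriterion_of_rate_bridge (r : ℝ) (h₁ : Rate r) (h₂ : RateBridge r) : TuranCriterion :=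
  h₂ h₁

/-! ### §C Costume lemma L1: a geometric TAIL bound already excludes zeros on the disc -/

section Costume

variable (t : ℝ)

/-- The vantage point `s₀ = 2 + it`. -/
def s₀ (t : ℝ) : ℂ := 2 + t * I

theorem s₀_re : (s₀ t).re = 2 := by simp [s₀]

theorem s₀_sub_one : s₀ t - 1 = 1 + t * I := by simp only [s₀]; ring

theorem one_lt_re_s₀ : 1 < (s₀ t).re := by rw [s₀_re]; norm_num

theorem s₀_ne_one : s₀ t ≠ 1 := fun h ↦ by
  have := congrArg Complex.re h
  rw [s₀_re] at this
  norm_num at this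

theorem riemannZeta_s₀_ne_zero : riemannZeta (s₀ t) ≠ 0 :=
  riemannZeta_ne_zero_of_one_le_re (by rw [s₀_re]; norm_num)

theorem riemannZeta₁_s₀_ne_zero : riemannZeta₁ (s₀ t) ≠ 0 := by
  rw [riemannZeta₁_eq_mul (s₀_ne_one t)]
  exact mul_ne_zero (sub_ne_zero.2 (s₀_ne_one t)) (riemannZeta_s₀_ne_zero t)

/-- `ζ₁'/ζ₁ = ζ'/ζ + (s-1)⁻¹` on a neighbourhood of `s₀` (the open half-plane `Re s > 1`). -/
theorem logDeriv_zeta₁_eventuallyEq :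
    logDeriv riemannZeta₁ =ᶠ[𝓝 (s₀ t)] (logDeriv riemannZeta + fun s ↦ (s - 1)⁻¹) := by
  have hU : IsOpen {s : ℂ | 1 < s.re} := isOpen_lt continuous_const Complex.continuous_re
  filter_upwards [hU.mem_nhds (one_lt_re_s₀ t)] with s hs
  have hs' : 1 < s.re := hs
  have hs1 : s ≠ 1 := fun h ↦ by rw [h] at hs'; norm_num at hs'
  have hζ : riemannZeta s ≠ 0 := riemannZeta_ne_zero_of_one_le_re hs'.le
  simp only [Pi.add_apply, logDeriv_riemannZeta_eq hs1 hζ, sub_add_cancel]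

theorem contDiffAt_logDeriv_zeta {n : WithTop ℕ∞} : ContDiffAt ℂ n (logDeriv riemannZeta) (s₀ t) := by
  have hO : IsOpen {s : ℂ | s ≠ 1} := isOpen_ne
  have hd : DifferentiableOn ℂ riemannZeta {s : ℂ | s ≠ 1} :=
    fun s hs ↦ (differentiableAt_riemannZeta hs).differentiableWithinAt
  have han : AnalyticOnNhd ℂ riemannZeta {s : ℂ | s ≠ 1} := hd.analyticOnNhd hO
  have h1 : s₀ t ∈ {s : ℂ | s ≠ 1} := s₀_ne_one t
  have hζ : AnalyticAt ℂ riemannZeta (s₀ t) := han _ h1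
  have hζ' : AnalyticAt ℂ (deriv riemannZeta) (s₀ t) := han.deriv _ h1
  exact (hζ'.div hζ (riemannZeta_s₀_ne_zero t)).contDiffAt

theorem contDiffAt_inv_sub_one {n : WithTop ℕ∞} : ContDiffAt ℂ n (fun s : ℂ ↦ (s - 1)⁻¹) (s₀ t) :=
  (contDiffAt_id.sub contDiffAt_const).inv (sub_ne_zero.2 (s₀_ne_one t))

theorem iteratedDeriv_inv_sub_one (n : ℕ) :
    iteratedDeriv n (fun s : ℂ ↦ (s - 1)⁻¹) (s₀ t) = (-1) ^ n * n ! * (s₀ t - 1) ^ (-1 - n : ℤ) := by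
  have h : (fun s : ℂ ↦ (s - 1)⁻¹) = fun x ↦ (1 * x - 1)⁻¹ := by simp
  rw [iteratedDeriv_eq_iterate, h, iter_deriv_inv_linear_sub n 1 1]
  simp

/-- H2: `(ζ₁'/ζ₁)^{(n)}(s₀) = (ζ'/ζ)^{(n)}(s₀) + (-1)^n n! (s₀-1)^{-1-n}`. -/
theorem iteratedDeriv_logDeriv_zeta₁ (n : ℕ) :
    iteratedDeriv n (logDeriv riemannZeta₁) (s₀ t) =
      iteratedDeriv n (logDeriv riemannZeta) (s₀ t) + (-1) ^ n * n ! * (s₀ t - 1) ^ (-1 - n : ℤ) := by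
  rw [(logDeriv_zeta₁_eventuallyEq t).iteratedDeriv_eq n,
    iteratedDeriv_add (contDiffAt_logDeriv_zeta t) (contDiffAt_inv_sub_one t),
    iteratedDeriv_inv_sub_one]

/-- The normalised shifted `ζ₁`: `Z_t(w) = ζ₁(s₀ + w)/ζ₁(s₀)`; entire, `Z_t(0) = 1`. -/
def Zfun (t : ℝ) (w : ℂ) : ℂ := riemannZeta₁ (s₀ t + w) / riemannZeta₁ (s₀ t)

theorem differentiable_Zfun : Differentiable ℂ (Zfun t) := by
  unfold Zfun
  exact (differentiable_riemannZeta₁.comp ((differentiable_const _).add differentiable_id)).div_const _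

theorem Zfun_zero : Zfun t 0 = 1 := by
  simp [Zfun, riemannZeta₁_s₀_ne_zero]

theorem deriv_log_Zfun_eventuallyEq :
    deriv (fun w ↦ Complex.log (Zfun t w)) =ᶠ[𝓝 0] fun w ↦ logDeriv riemannZeta₁ (s₀ t + w) := by
  have hpre : Zfun t ⁻¹' slitPlane ∈ 𝓝 (0 : ℂ) :=
    (differentiable_Zfun t).continuous.continuousAt.preimage_mem_nhds
      (isOpen_slitPlane.mem_nhds (by rw [Zfun_zero]; exact one_mem_slitPlane))
  filter_upwards [hpre] with w hw
  have hd : HasDerivAt (Zfun t) (deriv (Zfun t) w) w := ((differentiable_Zfun t) w).hasDerivAt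
  rw [(hd.clog hw).deriv]
  have hc : riemannZeta₁ (s₀ t) ≠ 0 := riemannZeta₁_s₀_ne_zero t
  have hderiv : deriv (Zfun t) w = deriv riemannZeta₁ (s₀ t + w) / riemannZeta₁ (s₀ t) := by
    have : Zfun t = fun w ↦ (fun w ↦ riemannZeta₁ (s₀ t + w)) w / riemannZeta₁ (s₀ t) := rfl
    rw [this, deriv_div_const, deriv_comp_const_add]
  rw [hderiv, Zfun, div_div_div_cancel_right₀ hc, logDeriv_apply]

theorem iteratedDeriv_log_Zfun_succ (n : ℕ) :
    iteratedDeriv (n + 1) (fun w ↦ Complex.log (Zfun t w)) 0 =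
      iteratedDeriv n (logDeriv riemannZeta₁) (s₀ t) := by
  rw [iteratedDeriv_succ', (deriv_log_Zfun_eventuallyEq t).iteratedDeriv_eq n,
    iteratedDeriv_comp_const_add n (logDeriv riemannZeta₁) (s₀ t)]
  simp

/-- The trivial-zero sum of the crux: `T_n(t) = Σ_m (4 + 2m + it)^{-(n+1)}`. -/
def trivSum (t : ℝ) (n : ℕ) : ℂ := ∑' m : ℕ, ((4 + 2 * (m : ℂ) + t * I) ^ (n + 1))⁻¹

theorem norm_trivTerm_le (n m : ℕ) (hn : 1 ≤ n) :
    ‖((4 + 2 * (m : ℂ) + t * I) ^ (n + 1))⁻¹‖ ≤ (1 / 2) ^ (n + 1) * (1 / ((m : ℝ) + 1) ^ 2) := by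
  set z : ℂ := 4 + 2 * (m : ℂ) + t * I with hz_def
  have hre : z.re = 2 * ((m : ℝ) + 2) := by simp [hz_def]; ring
  have hz : 2 * ((m : ℝ) + 2) ≤ ‖z‖ := hre ▸ Complex.re_le_norm z
  have hm0 : (0 : ℝ) ≤ m := Nat.cast_nonneg m
  have hpos : 0 < 2 * ((m : ℝ) + 2) := by positivity
  rw [norm_inv, norm_pow]
  have h1 : (2 * ((m : ℝ) + 2)) ^ (n + 1) ≤ ‖z‖ ^ (n + 1) := pow_le_pow_left₀ hpos.le hz _
  have h2 : (2 : ℝ) ^ (n + 1) * ((m : ℝ) + 1) ^ 2 ≤ (2 * ((m : ℝ) + 2)) ^ (n + 1) := by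
    rw [mul_pow]
    apply mul_le_mul_of_nonneg_left _ (by positivity)
    calc ((m : ℝ) + 1) ^ 2 ≤ ((m : ℝ) + 2) ^ 2 := by gcongr; norm_num
      _ ≤ ((m : ℝ) + 2) ^ (n + 1) := pow_le_pow_right₀ (by linarith) (by omega)
  have h3 : (0 : ℝ) < 2 ^ (n + 1) * ((m : ℝ) + 1) ^ 2 := by positivity
  calc (‖z‖ ^ (n + 1))⁻¹ ≤ ((2 : ℝ) ^ (n + 1) * ((m : ℝ) + 1) ^ 2)⁻¹ := inv_anti₀ h3 (h2.trans h1)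
    _ = (1 / 2) ^ (n + 1) * (1 / ((m : ℝ) + 1) ^ 2) := by
        rw [mul_inv, one_div, one_div, inv_pow]

theorem summable_one_div_succ_sq : Summable fun m : ℕ ↦ (1 : ℝ) / ((m : ℝ) + 1) ^ 2 := by
  have := (summable_nat_add_iff 1).2 hasSum_zeta_two.summable
  simpa using this

theorem tsum_one_div_succ_sq_le : ∑' m : ℕ, (1 : ℝ) / ((m : ℝ) + 1) ^ 2 ≤ 3 := by
  have h := hasSum_zeta_two.summable.sum_add_tsum_nat_add 1
  simp only [Finset.sum_range_one, Nat.cast_zero, ne_eq, OfNat.ofNat_ne_zero, not_false_eq_true,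
    zero_pow, div_zero, zero_add, Nat.cast_add, Nat.cast_one] at h
  rw [h, hasSum_zeta_two.tsum_eq]
  have := Real.pi_lt_four
  nlinarith [Real.pi_pos]

theorem norm_trivSum_le (n : ℕ) (hn : 1 ≤ n) : ‖trivSum t n‖ ≤ 3 * (1 / 2) ^ (n + 1) := by
  have hle := fun m ↦ norm_trivTerm_le t n m hn
  have hg : Summable fun m : ℕ ↦ (1 / 2 : ℝ) ^ (n + 1) * (1 / ((m : ℝ) + 1) ^ 2) :=
    summable_one_div_succ_sq.mul_left _
  have hf : Summable fun m : ℕ ↦ ‖((4 + 2 * (m : ℂ) + t * I) ^ (n + 1))⁻¹‖ :=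
    Summable.of_nonneg_of_le (fun _ ↦ norm_nonneg _) hle hg
  calc ‖trivSum t n‖ ≤ ∑' m : ℕ, ‖((4 + 2 * (m : ℂ) + t * I) ^ (n + 1))⁻¹‖ := norm_tsum_le_tsum_norm hf
    _ ≤ ∑' m : ℕ, (1 / 2 : ℝ) ^ (n + 1) * (1 / ((m : ℝ) + 1) ^ 2) := hf.tsum_le_tsum hle hg
    _ = (1 / 2 : ℝ) ^ (n + 1) * ∑' m : ℕ, (1 / ((m : ℝ) + 1) ^ 2) := tsum_mul_left
    _ ≤ (1 / 2 : ℝ) ^ (n + 1) * 3 := by gcongr; exact tsum_one_div_succ_sq_le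
    _ = 3 * (1 / 2) ^ (n + 1) := by ring

theorem turanCoeff_eq (n : ℕ) : turanCoeff t n =
    (-1) ^ n * iteratedDeriv n (logDeriv riemannZeta) (s₀ t) / (n ! : ℂ) + ((1 + t * I) ^ (n + 1))⁻¹
      - trivSum t n := rfl

/-- H5: the Taylor coefficient `(n+1)! a_{n+1}` of `log Z_t` at `0` is `(-1)^n n! (Z_n(t) + T_n(t))`. -/
theorem iteratedDeriv_log_Zfun_succ_eq (n : ℕ) :
    iteratedDeriv (n + 1) (fun w ↦ Complex.log (Zfun t w)) 0 =
      (-1) ^ n * n ! * (turanCoeff t n + trivSum t n) := by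
  rw [iteratedDeriv_log_Zfun_succ, iteratedDeriv_logDeriv_zeta₁, turanCoeff_eq]
  have hfac : (n ! : ℂ) ≠ 0 := by exact_mod_cast Nat.factorial_ne_zero n
  have hpow : (s₀ t - 1) ^ (-1 - n : ℤ) = ((1 + t * I) ^ (n + 1))⁻¹ := by
    rw [s₀_sub_one, show (-1 - n : ℤ) = -((n + 1 : ℕ) : ℤ) by push_cast; ring, zpow_neg, zpow_natCast]
  have hE : (-1 : ℂ) ^ n * (-1) ^ n = 1 := by
    rw [← pow_add, ← two_mul, pow_mul]; simp
  rw [hpow]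
  set D := iteratedDeriv n (logDeriv riemannZeta) (s₀ t)
  set P := ((1 + (t : ℂ) * I) ^ (n + 1))⁻¹
  set T := trivSum t n
  field_simp
  linear_combination (-(D : ℂ)) * hE

/-- **L1 (costume lemma, kernel-checked).** At ONE height `t`: a geometric bound with ratio `r⁻¹`
(`0 < r ≤ 2`) on the crux coefficients `Z_k(t)` for all LARGE `k > K` forces `ζ₁ ≠ 0` on the open
disc `B(2+it, r)`. Engine: the tree's `Literature.Analysis.Complex.ne_zero_of_taylor_bound`
(Taylor coefficients of `log Z` continue `log Z`, hence exclude zeros), applied to `Z_t`. -/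
theorem riemannZeta₁_ne_zero_of_tail {r C : ℝ} (hr : 0 < r) (hr2 : r ≤ 2) {K : ℕ}
    (h : ∀ k : ℕ, 1 ≤ k → K < k → ‖turanCoeff t k‖ ≤ C * r⁻¹ ^ k * Real.log (|t| + 3))
    {s : ℂ} (hs : dist s (s₀ t) < r) : riemannZeta₁ s ≠ 0 := by
  set a : ℕ → ℝ := fun n ↦ ‖((n ! : ℂ))⁻¹ * iteratedDeriv n (fun w ↦ Complex.log (Zfun t w)) 0‖
    with ha
  set L := Real.log (|t| + 3) with hL
  have hL0 : 0 < L := log_height_pos t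
  set B : ℝ := r⁻¹ with hB
  have hB0 : 0 < B := inv_pos.2 hr
  have hBhalf : (1 / 2 : ℝ) ≤ B := by rw [hB, one_div]; exact inv_anti₀ hr hr2
  set C' : ℝ := max C 0 with hC'
  have hC'0 : 0 ≤ C' := le_max_right _ _
  -- the coefficient bound `a_{m+1} ≤ ‖Z_m‖ + ‖T_m‖`
  have hcoef : ∀ m : ℕ, 1 ≤ m → a (m + 1) ≤ ‖turanCoeff t m‖ + 3 * (1 / 2) ^ (m + 1) := by
    intro m hm
    simp only [ha]
    rw [iteratedDeriv_log_Zfun_succ_eq]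
    rw [norm_mul, norm_mul, norm_mul, norm_inv, norm_pow, norm_neg, norm_one, one_pow, one_mul,
      Complex.norm_natCast, Complex.norm_natCast]
    have hratio : ((m + 1)! : ℝ)⁻¹ * (m ! : ℝ) ≤ 1 := by
      rw [inv_mul_le_iff₀ (by positivity), mul_one]
      exact_mod_cast Nat.factorial_le (Nat.le_succ m)
    calc (((m + 1)! : ℕ) : ℝ)⁻¹ * ((m ! : ℝ) * ‖turanCoeff t m + trivSum t m‖)
        = (((m + 1)! : ℝ)⁻¹ * (m ! : ℝ)) * ‖turanCoeff t m + trivSum t m‖ := by ring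
      _ ≤ 1 * ‖turanCoeff t m + trivSum t m‖ := by gcongr
      _ ≤ ‖turanCoeff t m‖ + ‖trivSum t m‖ := by rw [one_mul]; exact norm_add_le _ _
      _ ≤ _ := by gcongr; exact norm_trivSum_le t m hm
  -- the constant
  set A₁ : ℝ := C' * L * B + 3 * B ^ 2 with hA₁
  set A₂ : ℝ := ∑ n ∈ Finset.range (K + 2), a n * r ^ (n - 2) with hA₂
  have hA₁0 : 0 ≤ A₁ := by positivity
  have hA₂0 : 0 ≤ A₂ := Finset.sum_nonneg fun n _ ↦ by positivity
  have hK : ∀ n : ℕ, 2 ≤ n →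
      ‖((n ! : ℂ))⁻¹ * iteratedDeriv n (fun w ↦ Complex.log (Zfun t w)) 0‖ ≤ (A₁ + A₂) * B ^ (n - 2) := by
    intro n hn
    change a n ≤ _
    obtain ⟨j, rfl⟩ : ∃ j, n = j + 2 := ⟨n - 2, by omega⟩
    simp only [Nat.add_sub_cancel]
    by_cases hj : K < j + 1
    · -- tail: use the crux bound at k = j + 1
      have hb := h (j + 1) (by omega) hj
      have hc := hcoef (j + 1) (by omega)
      have hCle : C * B ^ (j + 1) * L ≤ C' * B ^ (j + 1) * L :=
        mul_le_mul_of_nonneg_right (mul_le_mul_of_nonneg_right (le_max_left _ _) (by positivity)) hL0.le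
      have hhalf : (1 / 2 : ℝ) ^ (j + 1 + 1) ≤ B ^ (j + 1 + 1) :=
        pow_le_pow_left₀ (by norm_num) hBhalf _
      calc a (j + 2) = a (j + 1 + 1) := rfl
        _ ≤ ‖turanCoeff t (j + 1)‖ + 3 * (1 / 2) ^ (j + 1 + 1) := hc
        _ ≤ C' * B ^ (j + 1) * L + 3 * B ^ (j + 1 + 1) := by gcongr; exact hb.trans hCle
        _ = A₁ * B ^ j := by rw [hA₁]; ring
        _ ≤ (A₁ + A₂) * B ^ j := by gcongr; linarith
    · -- head: finitely many coefficients
      push Not at hj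
      have hmem : j + 2 ∈ Finset.range (K + 2) := Finset.mem_range.2 (by omega)
      have hsingle : a (j + 2) * r ^ (j + 2 - 2) ≤ A₂ :=
        Finset.single_le_sum (f := fun n ↦ a n * r ^ (n - 2)) (fun n _ ↦ by positivity) hmem
      simp only [Nat.add_sub_cancel] at hsingle
      have hrB : r ^ j * B ^ j = 1 := by rw [hB, ← mul_pow, mul_inv_cancel₀ hr.ne', one_pow]
      calc a (j + 2) = a (j + 2) * r ^ j * B ^ j := by rw [mul_assoc, hrB, mul_one]
        _ ≤ A₂ * B ^ j := by gcongr
        _ ≤ (A₁ + A₂) * B ^ j := by gcongr; linarith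
  -- apply the continuation lemma on a disc of radius ρ ∈ (‖w‖, r)
  set w : ℂ := s - s₀ t with hw
  have hwr : ‖w‖ < r := by rwa [hw, ← dist_eq_norm]
  set ρ : ℝ := (‖w‖ + r) / 2 with hρ
  have hρ0 : 0 < ρ := by have := norm_nonneg w; positivity
  have hwρ : ‖w‖ < ρ := by rw [hρ]; linarith
  have hBρ : B * ρ < 1 := by
    rw [hB, inv_mul_lt_iff₀ hr, mul_one, hρ]; linarith
  have h0 : Zfun t 0 ∈ slitPlane := by rw [Zfun_zero]; exact one_mem_slitPlane
  have hZ := Literature.Analysis.Complex.ne_zero_of_taylor_bound (differentiable_Zfun t) h0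
    (add_nonneg hA₁0 hA₂0) hB0.le hK hρ0 hBρ hwρ
  -- `Z_t(w) = ζ₁(s)/ζ₁(s₀)`
  have : Zfun t w = riemannZeta₁ s / riemannZeta₁ (s₀ t) := by simp [Zfun, hw]
  rw [this] at hZ
  exact fun hzero ↦ hZ (by rw [hzero, zero_div])

/-- Distance from a point of the strip to the vantage point at its own height. -/
theorem dist_s₀_im (s : ℂ) : dist s (s₀ s.im) = |s.re - 2| := by
  have : s - s₀ s.im = ((s.re - 2 : ℝ) : ℂ) := by
    apply Complex.ext <;> simp [s₀]
  rw [dist_eq_norm, this, Complex.norm_real, Real.norm_eq_abs]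

/-- **Every rate-`r` TAIL piece is at least quasi-RH at `2 - r`.** -/
theorem quasiRH_of_rateTail {r : ℝ} (hr : 0 < r) (hr2 : r ≤ 2) (K : ℝ → ℕ)
    (h : Restrict r⁻¹ fun t k ↦ K t < k) : QuasiRiemannHypothesis (2 - r) := by
  obtain ⟨C, hC⟩ := h
  intro s hs hlt h1
  have hs1 : s ≠ 1 := fun h ↦ by rw [h] at h1; norm_num at h1
  refine riemannZeta₁_ne_zero_of_tail s.im hr hr2 (K := K s.im)
    (fun k hk hKk ↦ hC s.im k hk hKk) (s := s) ?_ ((riemannZeta₁_eq_zero_iff hs1).2 hs)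
  rw [dist_s₀_im, abs_of_nonpos (by linarith)]
  linarith

/-- The ladder piece `X_r` is at least the quasi-Riemann hypothesis at `2 - r`. -/
theorem quasiRH_of_rate {r : ℝ} (hr : 0 < r) (hr2 : r ≤ 2) (h : Rate r) :
    QuasiRiemannHypothesis (2 - r) :=
  quasiRH_of_rateTail hr hr2 (fun _ ↦ 0) (Restrict.anti (fun _ _ _ ↦ trivial) h)

/-- **`Tail K → RH` for EVERY cut-off `K : ℝ → ℕ`** — so every `k`-regime split `Head K ∧ Tail K` has a
summit-equivalent tail. -/
theorem riemannHypothesis_of_tail (K : ℝ → ℕ) (h : Tail K) : RiemannHypothesis := by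
  have h' : Restrict (3 / 2 : ℝ)⁻¹ fun t k ↦ K t < k := by
    rwa [show ((3 : ℝ) / 2)⁻¹ = 2 / 3 by norm_num]
  have := quasiRH_of_rateTail (by norm_num) (by norm_num) K h'
  rw [show (2 : ℝ) - 3 / 2 = 1 / 2 by norm_num] at this
  exact quasiRiemannHypothesis_one_half_iff_holds.1 this

/-- **X → RH** (the direction the route's `closes` obtains through `LocalDetection`; here without it). -/
theorem riemannHypothesis_of_turanCriterion (h : TuranCriterion) : RiemannHypothesis :=
  riemannHypothesis_of_tail (fun _ ↦ 0) (restrict_of_turanCriterion _ h)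

/-- Given the calibration support item `CriterionOfRH : RH → X` (stmt-2535, provable now), every
tail piece is literally equivalent to `X`: the `k`-regime split is `X ⟸ Head ∧ X`. -/
theorem tail_iff_of_criterionOfRH (hcal : CriterionOfRH) (K : ℝ → ℕ) : Tail K ↔ TuranCriterion :=
  ⟨fun h ↦ hcal (riemannHypothesis_of_tail K h), restrict_of_turanCriterion _⟩

/-- HIGH piece ⟹ no off-line zero above height `T₀`. -/
theorem no_offLine_zero_of_high {T₀ : ℝ} (h : High T₀) :
    ∀ s : ℂ, riemannZeta s = 0 → 1 / 2 < s.re → T₀ < |s.im| → False := by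
  obtain ⟨C, hC⟩ := h
  intro s hs hre hT
  have hs1 : s ≠ 1 := by rintro rfl; exact riemannZeta_one_ne_zero hs
  have hlt1 : s.re < 1 := by
    by_contra h'
    exact riemannZeta_ne_zero_of_one_le_re (not_lt.1 h') hs
  refine riemannZeta₁_ne_zero_of_tail s.im (r := 3 / 2) (C := C) (by norm_num) (by norm_num) (K := 0)
    (fun k hk _ ↦ ?_) (s := s) ?_ ((riemannZeta₁_eq_zero_iff hs1).2 hs)
  · have := hC s.im k hk hT
    rwa [show ((3 : ℝ) / 2)⁻¹ = 2 / 3 by norm_num]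
  · rw [dist_s₀_im, abs_of_nonpos (by linarith)]
    linarith

open Literature.NumberTheory.DiophantineGeometry in
/-- The height split is `X ⟸ (RH up to height T₀) ∧ (RH above T₀)`: the HIGH piece together with the
finite verification `RiemannHypothesisUpTo T₀` is already RH. -/
theorem riemannHypothesis_of_high_of_upTo {T₀ : ℝ} (h : High T₀) (hlow : RiemannHypothesisUpTo T₀) :
    RiemannHypothesis := by
  have key := no_offLine_zero_of_high h
  refine riemannHypothesis_iff_strip_holds.2 fun s hs h0 h1 ↦ ?_
  by_cases hT : |s.im| ≤ T₀
  · rcases lt_trichotomy s.im 0 with him | him | him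
    · exact hlow.re_eq_of_im_neg hs him (by rw [abs_of_neg him] at hT; exact hT)
    · exact absurd hs (riemannZeta_ne_zero_of_im_eq_zero_of_pos_of_lt_one him h0 h1)
    · exact hlow s hs him (by rw [abs_of_pos him] at hT; exact hT)
  · push Not at hT
    rcases lt_trichotomy s.re (1 / 2) with hlt | heq | hgt
    · have hs' := GeneralizedRH.riemannZeta_one_sub_eq_zero hs h0 h1
      refine (key (1 - s) hs' (by simp; linarith) ?_).elim
      simpa using hT
    · exact heq
    · exact (key s hs hgt hT).elim

/-- **The qualitative shadow is already RH.** If at every height `t` the coefficients satisfy, for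
every `ε > 0`, an EVENTUAL bound `‖Z_k(t)‖ ≤ C_{t,ε} (2/3 + ε)^k` (i.e. `limsup |Z_k(t)|^{1/k} ≤ 2/3`
pointwise in `t`, no uniformity in `t`, no `log(|t|+3)`), then RH. So `X` has no qualitative slack:
between the trivial regime and RH there is no intermediate statement of this shape. -/
theorem riemannHypothesis_of_limsupShadow
    (h : ∀ t : ℝ, ∀ ε : ℝ, 0 < ε → ∃ K : ℕ, ∃ C : ℝ, ∀ k : ℕ, K < k →
      ‖turanCoeff t k‖ ≤ C * (2 / 3 + ε) ^ k) :
    RiemannHypothesis := by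
  refine quasiRiemannHypothesis_one_half_iff_holds.1 fun s hs hlt h1 ↦ ?_
  have hs1 : s ≠ 1 := fun h ↦ by rw [h] at h1; norm_num at h1
  -- radius r with 2 - re s < r < 3/2, ratio q = r⁻¹ = 2/3 + ε
  set r : ℝ := (2 - s.re + 3 / 2) / 2 with hr
  have hr0 : 0 < r := by rw [hr]; linarith
  have hr32 : r < 3 / 2 := by rw [hr]; linarith
  have hrd : 2 - s.re < r := by rw [hr]; linarith
  set ε : ℝ := r⁻¹ - 2 / 3 with hε
  have hε0 : 0 < ε := by
    rw [hε, sub_pos, lt_inv_comm₀ (by norm_num) hr0]; norm_num; linarith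
  obtain ⟨K, C, hC⟩ := h s.im ε hε0
  have hL := log_height_pos s.im
  refine riemannZeta₁_ne_zero_of_tail s.im (r := r) (C := C / Real.log (|s.im| + 3)) hr0 (by linarith)
    (K := K) (fun k _ hKk ↦ ?_) (s := s) ?_ ((riemannZeta₁_eq_zero_iff hs1).2 hs)
  · have := hC k hKk
    rw [show (2 / 3 + ε : ℝ) = r⁻¹ by rw [hε]; ring] at this
    rwa [div_mul_eq_mul_div, div_mul_cancel₀ _ hL.ne']
  · rw [dist_s₀_im, abs_of_nonpos (by linarith)]
    linarith

/-! ### §C' Parity (costume lemma L2): the ODD-`k` half alone excludes zeros — Weil's even-power trick -/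

theorem logDeriv_Zfun (v : ℂ) : logDeriv (Zfun t) v = logDeriv riemannZeta₁ (s₀ t + v) := by
  have hc : riemannZeta₁ (s₀ t) ≠ 0 := riemannZeta₁_s₀_ne_zero t
  have hderiv : deriv (Zfun t) v = deriv riemannZeta₁ (s₀ t + v) / riemannZeta₁ (s₀ t) := by
    have : Zfun t = fun w ↦ (fun w ↦ riemannZeta₁ (s₀ t + w)) w / riemannZeta₁ (s₀ t) := rfl
    rw [this, deriv_div_const, deriv_comp_const_add]
  rw [logDeriv_apply, hderiv, Zfun, div_div_div_cancel_right₀ hc, logDeriv_apply]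

theorem contDiffAt_logDeriv_zeta₁ {n : WithTop ℕ∞} {s : ℂ} (hs : riemannZeta₁ s ≠ 0) :
    ContDiffAt ℂ n (logDeriv riemannZeta₁) s := by
  have hζ : AnalyticAt ℂ riemannZeta₁ s := differentiable_riemannZeta₁.analyticAt _
  exact (hζ.deriv.div hζ hs).contDiffAt

/-- `(ζ₁'/ζ₁)^{(n)}(s₀) = (-1)^n n! (Z_n(t) + T_n(t))`. -/
theorem iteratedDeriv_logDeriv_zeta₁_eq (n : ℕ) :
    iteratedDeriv n (logDeriv riemannZeta₁) (s₀ t) = (-1) ^ n * n ! * (turanCoeff t n + trivSum t n) := by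
  rw [← iteratedDeriv_log_Zfun_succ, iteratedDeriv_log_Zfun_succ_eq]

/-- The even entire function `E_t(w) = Z_t(w) Z_t(-w)` (`E_t(0) = 1`). -/
def Zeven (t : ℝ) (w : ℂ) : ℂ := Zfun t w * Zfun t (-w)

theorem differentiable_Zeven : Differentiable ℂ (Zeven t) :=
  (differentiable_Zfun t).mul ((differentiable_Zfun t).comp differentiable_neg)

theorem Zeven_zero : Zeven t 0 = 1 := by simp [Zeven, Zfun_zero]

theorem deriv_log_Zeven_eventuallyEq :
    deriv (fun w ↦ Complex.log (Zeven t w)) =ᶠ[𝓝 0]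
      fun w ↦ logDeriv riemannZeta₁ (s₀ t + w) - logDeriv riemannZeta₁ (s₀ t - w) := by
  have h1 : ∀ᶠ w in 𝓝 (0 : ℂ), Zeven t w ∈ slitPlane :=
    (differentiable_Zeven t).continuous.continuousAt.preimage_mem_nhds
      (isOpen_slitPlane.mem_nhds (by rw [Zeven_zero]; exact one_mem_slitPlane))
  have h2 : ∀ᶠ w in 𝓝 (0 : ℂ), Zfun t w ≠ 0 :=
    (differentiable_Zfun t).continuous.continuousAt.eventually_ne (by rw [Zfun_zero]; exact one_ne_zero)
  have h3 : ∀ᶠ w in 𝓝 (0 : ℂ), Zfun t (-w) ≠ 0 := by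
    have hc : ContinuousAt (fun w ↦ Zfun t (-w)) 0 :=
      ((differentiable_Zfun t).continuous.comp continuous_neg).continuousAt
    exact hc.eventually_ne (by simp [Zfun_zero])
  filter_upwards [h1, h2, h3] with w hw1 hw2 hw3
  have hd : HasDerivAt (Zeven t) (deriv (Zeven t) w) w := ((differentiable_Zeven t) w).hasDerivAt
  rw [(hd.clog hw1).deriv, ← logDeriv_apply]
  have hmul : logDeriv (Zeven t) w = logDeriv (Zfun t) w + logDeriv (fun w ↦ Zfun t (-w)) w := by
    show logDeriv (fun w ↦ Zfun t w * (fun w ↦ Zfun t (-w)) w) w = _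
    exact logDeriv_mul w hw2 hw3 ((differentiable_Zfun t) w)
      (((differentiable_Zfun t).comp differentiable_neg) w)
  have hneg : logDeriv (fun w ↦ Zfun t (-w)) w = -logDeriv (Zfun t) (-w) := by
    rw [show (fun w ↦ Zfun t (-w)) = Zfun t ∘ Neg.neg from rfl,
      logDeriv_comp ((differentiable_Zfun t) _) differentiable_neg.differentiableAt, deriv_neg,
      mul_neg_one]
  rw [hmul, hneg, logDeriv_Zfun, logDeriv_Zfun]
  simp only [sub_eq_add_neg]

theorem iteratedDeriv_log_Zeven_succ (n : ℕ) :
    iteratedDeriv (n + 1) (fun w ↦ Complex.log (Zeven t w)) 0 =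
      (1 - (-1) ^ n) * iteratedDeriv n (logDeriv riemannZeta₁) (s₀ t) := by
  rw [iteratedDeriv_succ', (deriv_log_Zeven_eventuallyEq t).iteratedDeriv_eq n]
  have h0 : riemannZeta₁ (s₀ t + 0) ≠ 0 := by rw [add_zero]; exact riemannZeta₁_s₀_ne_zero t
  have h0' : riemannZeta₁ (s₀ t - 0) ≠ 0 := by rw [sub_zero]; exact riemannZeta₁_s₀_ne_zero t
  have hf : ContDiffAt ℂ n (fun w ↦ logDeriv riemannZeta₁ (s₀ t + w)) 0 :=
    (contDiffAt_logDeriv_zeta₁ h0).fun_comp 0 (contDiffAt_const.add contDiffAt_id)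
  have hg : ContDiffAt ℂ n (fun w ↦ logDeriv riemannZeta₁ (s₀ t - w)) 0 :=
    (contDiffAt_logDeriv_zeta₁ h0').fun_comp 0 (contDiffAt_const.sub contDiffAt_id)
  rw [show (fun w ↦ logDeriv riemannZeta₁ (s₀ t + w) - logDeriv riemannZeta₁ (s₀ t - w)) =
      (fun w ↦ logDeriv riemannZeta₁ (s₀ t + w)) - fun w ↦ logDeriv riemannZeta₁ (s₀ t - w) from rfl,
    iteratedDeriv_sub hf hg, iteratedDeriv_comp_const_add, iteratedDeriv_comp_const_sub]
  simp only [add_zero, sub_zero, smul_eq_mul]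
  ring

/-- **L2 (parity costume lemma, kernel-checked).** The crux bound at ONE height `t` for the ODD `k > K`
alone (even exponents `k+1`) forces `ζ₁ ≠ 0` on `B(2+it, r)`: the even function `Z_t(w)Z_t(-w)` has
log-Taylor coefficients `2a_{2j}` and no others, and its zeros contain those of `Z_t`. -/
theorem riemannZeta₁_ne_zero_of_oddTail {r C : ℝ} (hr : 0 < r) (hr2 : r ≤ 2) {K : ℕ}
    (h : ∀ k : ℕ, 1 ≤ k → K < k → Odd k → ‖turanCoeff t k‖ ≤ C * r⁻¹ ^ k * Real.log (|t| + 3))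
    {s : ℂ} (hs : dist s (s₀ t) < r) : riemannZeta₁ s ≠ 0 := by
  set a : ℕ → ℝ := fun n ↦ ‖((n ! : ℂ))⁻¹ * iteratedDeriv n (fun w ↦ Complex.log (Zeven t w)) 0‖
    with ha
  set L := Real.log (|t| + 3) with hL
  have hL0 : 0 < L := log_height_pos t
  set B : ℝ := r⁻¹ with hB
  have hB0 : 0 < B := inv_pos.2 hr
  have hBhalf : (1 / 2 : ℝ) ≤ B := by rw [hB, one_div]; exact inv_anti₀ hr hr2
  set C' : ℝ := max C 0 with hC'
  have hC'0 : 0 ≤ C' := le_max_right _ _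
  -- coefficient formula: `a_{m+1} = |1 - (-1)^m| · m!/(m+1)! · ‖Z_m + T_m‖`
  have hcoef : ∀ m : ℕ, 1 ≤ m →
      a (m + 1) ≤ ‖(1 : ℂ) - (-1) ^ m‖ * (‖turanCoeff t m‖ + 3 * (1 / 2) ^ (m + 1)) := by
    intro m hm
    simp only [ha]
    rw [iteratedDeriv_log_Zeven_succ, iteratedDeriv_logDeriv_zeta₁_eq]
    rw [norm_mul, norm_mul, norm_mul, norm_mul, norm_inv, norm_pow, norm_neg, norm_one, one_pow,
      one_mul, Complex.norm_natCast, Complex.norm_natCast]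
    have hratio : ((m + 1)! : ℝ)⁻¹ * (m ! : ℝ) ≤ 1 := by
      rw [inv_mul_le_iff₀ (by positivity), mul_one]
      exact_mod_cast Nat.factorial_le (Nat.le_succ m)
    have hE0 : 0 ≤ ‖(1 : ℂ) - (-1) ^ m‖ := norm_nonneg _
    calc (((m + 1)! : ℕ) : ℝ)⁻¹ * (‖(1 : ℂ) - (-1) ^ m‖ * ((m ! : ℝ) * ‖turanCoeff t m + trivSum t m‖))
        = ‖(1 : ℂ) - (-1) ^ m‖ * ((((m + 1)! : ℝ)⁻¹ * (m ! : ℝ)) * ‖turanCoeff t m + trivSum t m‖) := by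
          ring
      _ ≤ ‖(1 : ℂ) - (-1) ^ m‖ * (1 * ‖turanCoeff t m + trivSum t m‖) := by gcongr
      _ ≤ ‖(1 : ℂ) - (-1) ^ m‖ * (‖turanCoeff t m‖ + ‖trivSum t m‖) := by
          rw [one_mul]; gcongr; exact norm_add_le _ _
      _ ≤ _ := by gcongr; exact norm_trivSum_le t m hm
  set A₁ : ℝ := 2 * (C' * L * B + 3 * B ^ 2) with hA₁
  set A₂ : ℝ := ∑ n ∈ Finset.range (K + 2), a n * r ^ (n - 2) with hA₂
  have hA₁0 : 0 ≤ A₁ := by positivity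
  have hA₂0 : 0 ≤ A₂ := Finset.sum_nonneg fun n _ ↦ by positivity
  have hK : ∀ n : ℕ, 2 ≤ n →
      ‖((n ! : ℂ))⁻¹ * iteratedDeriv n (fun w ↦ Complex.log (Zeven t w)) 0‖ ≤ (A₁ + A₂) * B ^ (n - 2) := by
    intro n hn
    change a n ≤ _
    obtain ⟨j, rfl⟩ : ∃ j, n = j + 2 := ⟨n - 2, by omega⟩
    simp only [Nat.add_sub_cancel]
    by_cases hj : K < j + 1
    · have hc := hcoef (j + 1) (by omega)
      rcases Nat.even_or_odd (j + 1) with hev | hodd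
      · -- even `m`: the coefficient vanishes
        have : ‖(1 : ℂ) - (-1) ^ (j + 1)‖ = 0 := by rw [hev.neg_one_pow]; simp
        rw [this, zero_mul] at hc
        exact hc.trans (by positivity)
      · have hb := h (j + 1) (by omega) hj hodd
        have h2 : ‖(1 : ℂ) - (-1) ^ (j + 1)‖ = 2 := by
          rw [hodd.neg_one_pow]; norm_num
        rw [h2] at hc
        have hCle : C * B ^ (j + 1) * L ≤ C' * B ^ (j + 1) * L :=
          mul_le_mul_of_nonneg_right (mul_le_mul_of_nonneg_right (le_max_left _ _) (by positivity))
            hL0.le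
        have hhalf : (1 / 2 : ℝ) ^ (j + 1 + 1) ≤ B ^ (j + 1 + 1) :=
          pow_le_pow_left₀ (by norm_num) hBhalf _
        calc a (j + 2) = a (j + 1 + 1) := rfl
          _ ≤ 2 * (‖turanCoeff t (j + 1)‖ + 3 * (1 / 2) ^ (j + 1 + 1)) := hc
          _ ≤ 2 * (C' * B ^ (j + 1) * L + 3 * B ^ (j + 1 + 1)) := by gcongr; exact hb.trans hCle
          _ = A₁ * B ^ j := by rw [hA₁]; ring
          _ ≤ (A₁ + A₂) * B ^ j := by gcongr; linarith
    · push Not at hj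
      have hmem : j + 2 ∈ Finset.range (K + 2) := Finset.mem_range.2 (by omega)
      have hsingle : a (j + 2) * r ^ (j + 2 - 2) ≤ A₂ :=
        Finset.single_le_sum (f := fun n ↦ a n * r ^ (n - 2)) (fun n _ ↦ by positivity) hmem
      simp only [Nat.add_sub_cancel] at hsingle
      have hrB : r ^ j * B ^ j = 1 := by rw [hB, ← mul_pow, mul_inv_cancel₀ hr.ne', one_pow]
      calc a (j + 2) = a (j + 2) * r ^ j * B ^ j := by rw [mul_assoc, hrB, mul_one]
        _ ≤ A₂ * B ^ j := by gcongr
        _ ≤ (A₁ + A₂) * B ^ j := by gcongr; linarith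
  set w : ℂ := s - s₀ t with hw
  have hwr : ‖w‖ < r := by rwa [hw, ← dist_eq_norm]
  set ρ : ℝ := (‖w‖ + r) / 2 with hρ
  have hρ0 : 0 < ρ := by have := norm_nonneg w; positivity
  have hwρ : ‖w‖ < ρ := by rw [hρ]; linarith
  have hBρ : B * ρ < 1 := by
    rw [hB, inv_mul_lt_iff₀ hr, mul_one, hρ]; linarith
  have h0 : Zeven t 0 ∈ slitPlane := by rw [Zeven_zero]; exact one_mem_slitPlane
  have hZ := Literature.Analysis.Complex.ne_zero_of_taylor_bound (differentiable_Zeven t) h0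
    (add_nonneg hA₁0 hA₂0) hB0.le hK hρ0 hBρ hwρ
  have hZw : Zfun t w ≠ 0 := left_ne_zero_of_mul hZ
  have : Zfun t w = riemannZeta₁ s / riemannZeta₁ (s₀ t) := by simp [Zfun, hw]
  rw [this] at hZw
  exact fun hzero ↦ hZw (by rw [hzero, zero_div])

/-- **The ODD-`k` half of any tail is already RH** (so the parity split fails (c) on `OddK`). -/
theorem riemannHypothesis_of_oddTail (K : ℝ → ℕ) (h : Restrict (2 / 3) fun t k ↦ K t < k ∧ Odd k) :
    RiemannHypothesis := by
  obtain ⟨C, hC⟩ := h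
  refine quasiRiemannHypothesis_one_half_iff_holds.1 fun s hs hlt h1 ↦ ?_
  have hs1 : s ≠ 1 := fun h ↦ by rw [h] at h1; norm_num at h1
  refine riemannZeta₁_ne_zero_of_oddTail s.im (r := 3 / 2) (C := C) (by norm_num) (by norm_num)
    (K := K s.im) (fun k hk hKk hodd ↦ ?_) (s := s) ?_ ((riemannZeta₁_eq_zero_iff hs1).2 hs)
  · have := hC s.im k hk ⟨hKk, hodd⟩
    rwa [show ((3 : ℝ) / 2)⁻¹ = 2 / 3 by norm_num]
  · rw [dist_s₀_im, abs_of_nonpos (by linarith)]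
    linarith

theorem riemannHypothesis_of_oddK (h : OddK) : RiemannHypothesis :=
  riemannHypothesis_of_oddTail (fun _ ↦ 0) (Restrict.anti (fun _ _ hk ↦ hk.2) h)

end Costume

/-! ### §T The trivial regime is a THEOREM: every head with `(3/2)^{K(t)} ≤ B·log(|t|+3)` holds unconditionally

Prime side (2533 PrimeSide, here via Mathlib's `LSeries_vonMangoldt_eq_deriv_riemannZeta_div` + `LSeries_iteratedDeriv`):
`(ζ′/ζ)^{(k)}(2+it) = −(−1)^k L(log^k·Λ)(2+it)`, so `‖(ζ′/ζ)^{(k)}(2+it)‖/k! ≤ L(log^k·Λ)(2)/k! = ‖(ζ′/ζ)^{(k)}(2)‖/k!`, and the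
latter is `≤ 1 + M` uniformly in `k` by Cauchy's estimate for `ζ₁′/ζ₁` on `|s−2| ≤ 1` (`ζ ≠ 0` on `Re s ≥ 1`). Hence
`‖Z_k(t)‖ ≤ M + 3` for all `t`, `k` (`exists_norm_turanCoeff_le`), and the crux's inequality is EMPTY wherever
`C (2/3)^k log(|t|+3) ≥ M + 3`, i.e. on every head `k ≤ K(t)` with `(3/2)^{K(t)} ≤ B log(|t|+3)` (`head_of_pow_le`):
the `k`-split at `K(t) ≈ 2.47 log log|t|` is `X ⟸ (theorem) ∧ (RH)`. -/

section TrivialRegime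

open LSeries ArithmeticFunction
open scoped LSeries.notation ComplexOrder

variable (t : ℝ)

theorem s₀_zero : s₀ 0 = 2 := by simp [s₀]

theorem abscissa_vonMangoldt_le_one : abscissaOfAbsConv ↗Λ ≤ 1 :=
  abscissaOfAbsConv_le_of_forall_lt_LSeriesSummable fun y hy ↦
    LSeriesSummable_vonMangoldt (by simpa using hy)

theorem abscissa_vonMangoldt_lt_re_s₀ : abscissaOfAbsConv ↗Λ < ((s₀ t).re : EReal) := by
  rw [s₀_re]
  exact abscissa_vonMangoldt_le_one.trans_lt (by exact_mod_cast (by norm_num : (1 : ℝ) < 2))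

/-- `ζ′/ζ = −L(Λ)` near `s₀`. -/
theorem logDeriv_zeta_eventuallyEq_neg_LSeries :
    logDeriv riemannZeta =ᶠ[𝓝 (s₀ t)] fun s ↦ -L ↗Λ s := by
  have hU : IsOpen {s : ℂ | 1 < s.re} := isOpen_lt continuous_const Complex.continuous_re
  filter_upwards [hU.mem_nhds (one_lt_re_s₀ t)] with s hs
  have hs' : 1 < s.re := hs
  rw [logDeriv_apply, LSeries_vonMangoldt_eq_deriv_riemannZeta_div hs', neg_div, neg_neg]

/-- `(ζ′/ζ)^{(k)}(s₀) = −(−1)^k L(log^k Λ)(s₀)`. -/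
theorem iteratedDeriv_logDeriv_zeta_eq_LSeries (k : ℕ) :
    iteratedDeriv k (logDeriv riemannZeta) (s₀ t) = -((-1) ^ k * L (logMul^[k] ↗Λ) (s₀ t)) := by
  rw [(logDeriv_zeta_eventuallyEq_neg_LSeries t).iteratedDeriv_eq k, iteratedDeriv_fun_neg,
    LSeries_iteratedDeriv k (abscissa_vonMangoldt_lt_re_s₀ t)]

theorem logMul_iterate_apply (k n : ℕ) :
    (logMul^[k] ↗Λ) n = (Complex.log n) ^ k * (Λ n : ℂ) := by
  induction k with
  | zero => simp
  | succ k ih =>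
    rw [Function.iterate_succ_apply', logMul, ih]
    ring

/-- The coefficients `log^k n · Λ(n)` are non-negative reals. -/
theorem logMul_iterate_nonneg (k n : ℕ) : (0 : ℂ) ≤ (logMul^[k] ↗Λ) n := by
  rw [logMul_iterate_apply, ← Complex.natCast_log, ← Complex.ofReal_pow, ← Complex.ofReal_mul]
  exact Complex.zero_le_real.2 (mul_nonneg (pow_nonneg (Real.log_natCast_nonneg n) k) vonMangoldt_nonneg)

theorem norm_eq_re_of_nonneg {z : ℂ} (h : 0 ≤ z) : ‖z‖ = z.re := by
  obtain ⟨hre, him⟩ := Complex.nonneg_iff.1 h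
  have : z = (z.re : ℂ) := Complex.ext rfl (by simp [← him])
  rw [this, Complex.norm_real, Real.norm_of_nonneg hre, Complex.ofReal_re]

theorem lseriesSummable_logMul_iterate (k : ℕ) : LSeriesSummable (logMul^[k] ↗Λ) (s₀ t) :=
  LSeriesSummable_of_abscissaOfAbsConv_lt_re
    (absicssaOfAbsConv_logPowMul.symm ▸ abscissa_vonMangoldt_lt_re_s₀ t)

/-- At the real point `2` the L-series of the non-negative sequence dominates the sum of the norms of
its terms (they are equal; `≤` is what we need). -/
theorem tsum_norm_term_le_norm_LSeries (k : ℕ) :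
    ∑' n : ℕ, ‖term (logMul^[k] ↗Λ) (s₀ 0) n‖ ≤ ‖L (logMul^[k] ↗Λ) (s₀ 0)‖ := by
  have hs : Summable fun n ↦ term (logMul^[k] ↗Λ) (s₀ 0) n := lseriesSummable_logMul_iterate 0 k
  have hnn : ∀ n, (0 : ℂ) ≤ term (logMul^[k] ↗Λ) (s₀ 0) n := fun n ↦ by
    rw [s₀_zero, show (2 : ℂ) = ((2 : ℝ) : ℂ) by norm_num]
    exact term_nonneg (logMul_iterate_nonneg k n) 2
  calc ∑' n : ℕ, ‖term (logMul^[k] ↗Λ) (s₀ 0) n‖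
      = ∑' n : ℕ, (term (logMul^[k] ↗Λ) (s₀ 0) n).re := tsum_congr fun n ↦ norm_eq_re_of_nonneg (hnn n)
    _ = (L (logMul^[k] ↗Λ) (s₀ 0)).re := (Complex.re_tsum hs).symm
    _ ≤ ‖L (logMul^[k] ↗Λ) (s₀ 0)‖ := Complex.re_le_norm _

/-- Cauchy's estimate for `ζ₁′/ζ₁` on the disc `|s − 2| ≤ 1` (inside `Re s ≥ 1`, where `ζ₁ ≠ 0`). -/
theorem exists_bound_iteratedDeriv_logDeriv_zeta₁_two :
    ∃ M : ℝ, 0 ≤ M ∧ ∀ k : ℕ, ‖iteratedDeriv k (logDeriv riemannZeta₁) 2‖ ≤ k ! * M := by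
  set U : Set ℂ := {s : ℂ | riemannZeta₁ s ≠ 0} with hU_def
  have hdiff : DifferentiableOn ℂ (logDeriv riemannZeta₁) U := fun s hs ↦
    ((((differentiable_riemannZeta₁.analyticAt s).deriv).differentiableAt).div
      (differentiable_riemannZeta₁ s) hs).differentiableWithinAt
  have hsub : closedBall (2 : ℂ) 1 ⊆ U := by
    intro s hs hzero
    have hs1 : s ≠ 1 := ne_one_of_riemannZeta₁_eq_zero hzero
    have hre : 1 ≤ s.re := by
      rw [mem_closedBall, dist_eq_norm] at hs
      have := Complex.re_le_norm (2 - s)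
      rw [norm_sub_rev] at hs
      simp only [Complex.sub_re, Complex.re_ofNat] at this
      linarith
    exact riemannZeta_ne_zero_of_one_le_re hre ((riemannZeta₁_eq_zero_iff hs1).1 hzero)
  have hdc : DiffContOnCl ℂ (logDeriv riemannZeta₁) (ball (2 : ℂ) 1) := hdiff.diffContOnCl_ball hsub
  obtain ⟨M, hM⟩ := (isCompact_sphere (2 : ℂ) 1).exists_bound_of_continuousOn
    (hdiff.continuousOn.mono (sphere_subset_closedBall.trans hsub))
  refine ⟨max M 0, le_max_right _ _, fun k ↦ ?_⟩
  have h := Complex.norm_iteratedDeriv_le_of_forall_mem_sphere_norm_le k one_pos hdc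
    (fun z hz ↦ (hM z hz).trans (le_max_left M 0))
  simpa using h

/-- **Uniform bound for the crux coefficients:** `‖Z_k(t)‖ ≤ M₀` for all `t` and all `k ≥ 1`. -/
theorem exists_norm_turanCoeff_le : ∃ M₀ : ℝ, ∀ (t : ℝ) (k : ℕ), 1 ≤ k → ‖turanCoeff t k‖ ≤ M₀ := by
  obtain ⟨M, hM0, hM⟩ := exists_bound_iteratedDeriv_logDeriv_zeta₁_two
  refine ⟨M + 1 + 1 + 3 / 4, fun t k hk ↦ ?_⟩
  -- (1) the prime-side term: ‖(ζ′/ζ)^{(k)}(s₀ t)‖ ≤ k! (M + 1)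
  have hD : ‖iteratedDeriv k (logDeriv riemannZeta) (s₀ t)‖ ≤ k ! * (M + 1) := by
    have hsum : Summable fun n ↦ ‖term (logMul^[k] ↗Λ) (s₀ t) n‖ :=
      (lseriesSummable_logMul_iterate t k).norm
    calc ‖iteratedDeriv k (logDeriv riemannZeta) (s₀ t)‖
        = ‖L (logMul^[k] ↗Λ) (s₀ t)‖ := by
          rw [iteratedDeriv_logDeriv_zeta_eq_LSeries]; simp
      _ ≤ ∑' n : ℕ, ‖term (logMul^[k] ↗Λ) (s₀ t) n‖ := norm_tsum_le_tsum_norm hsum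
      _ = ∑' n : ℕ, ‖term (logMul^[k] ↗Λ) (s₀ 0) n‖ := by
          refine tsum_congr fun n ↦ ?_
          simp only [norm_term_eq, s₀_re]
      _ ≤ ‖L (logMul^[k] ↗Λ) (s₀ 0)‖ := tsum_norm_term_le_norm_LSeries k
      _ = ‖iteratedDeriv k (logDeriv riemannZeta) (s₀ 0)‖ := by
          rw [iteratedDeriv_logDeriv_zeta_eq_LSeries]; simp
      _ = ‖iteratedDeriv k (logDeriv riemannZeta₁) 2 - (-1) ^ k * k ! * (2 - 1) ^ (-1 - k : ℤ)‖ := by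
          rw [← s₀_zero, iteratedDeriv_logDeriv_zeta₁, add_sub_cancel_right]
      _ ≤ ‖iteratedDeriv k (logDeriv riemannZeta₁) 2‖ + ‖(-1 : ℂ) ^ k * k ! * (2 - 1) ^ (-1 - k : ℤ)‖ :=
          norm_sub_le _ _
      _ ≤ k ! * M + k ! := by
          gcongr
          · exact hM k
          · rw [show (2 : ℂ) - 1 = 1 by norm_num, one_zpow, mul_one, norm_mul, norm_pow, norm_neg,
              norm_one, one_pow, one_mul, Complex.norm_natCast]
      _ = k ! * (M + 1) := by ring
  -- (2) the pole term
  have hP : ‖((1 + t * I) ^ (k + 1))⁻¹‖ ≤ 1 := by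
    rw [norm_inv, norm_pow]
    have h1 : (1 : ℝ) ≤ ‖(1 : ℂ) + t * I‖ := by
      have := Complex.re_le_norm ((1 : ℂ) + t * I)
      simpa using this
    exact inv_le_one_of_one_le₀ (one_le_pow₀ h1)
  -- (3) the trivial-zero sum
  have hT : ‖trivSum t k‖ ≤ 3 / 4 :=
    (norm_trivSum_le t k hk).trans (by
      have : (1 / 2 : ℝ) ^ (k + 1) ≤ (1 / 2) ^ 2 := pow_le_pow_of_le_one (by norm_num) (by norm_num) (by omega)
      linarith)
  have hfac : (0 : ℝ) < k ! := by positivity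
  have hfirst : ‖(-1 : ℂ) ^ k * iteratedDeriv k (logDeriv riemannZeta) (s₀ t) / (k ! : ℂ)‖ ≤ M + 1 := by
    rw [norm_div, norm_mul, norm_pow, norm_neg, norm_one, one_pow, one_mul, Complex.norm_natCast,
      div_le_iff₀ hfac]
    linarith
  calc ‖turanCoeff t k‖
      ≤ ‖(-1 : ℂ) ^ k * iteratedDeriv k (logDeriv riemannZeta) (s₀ t) / (k ! : ℂ)‖
          + ‖((1 + t * I) ^ (k + 1))⁻¹‖ + ‖trivSum t k‖ := by
        rw [turanCoeff_eq]; exact norm_sub_le_of_le (norm_add_le _ _) le_rfl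
    _ ≤ M + 1 + 1 + 3 / 4 := by linarith

/-- **The trivial regime (lemma T, kernel-checked).** For any `B` and any cut-off with `(3/2)^{K(t)} ≤ B log(|t|+3)`
(e.g. `K(t) = ⌊log_{3/2}(B log(|t|+3))⌋ ≈ 2.47 log log|t|`), the HEAD piece `Head K` is a theorem: in that range the crux
asks for no cancellation at all. -/
theorem head_of_pow_le {B : ℝ} (K : ℝ → ℕ) (hK : ∀ t, (3 / 2 : ℝ) ^ K t ≤ B * Real.log (|t| + 3)) : Head K := by
  obtain ⟨M₀, hM₀⟩ := exists_norm_turanCoeff_le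
  have hB : 0 < B := by
    have h := hK 0
    have hpos : (0 : ℝ) < (3 / 2) ^ K 0 := by positivity
    have hL := log_height_pos 0
    by_contra hB
    push Not at hB
    have h2 : B * Real.log (|(0 : ℝ)| + 3) ≤ 0 := mul_nonpos_of_nonpos_of_nonneg hB hL.le
    exact absurd (h.trans h2) (not_le.2 hpos)
  refine ⟨max M₀ 0 * B, fun t k hk hkK ↦ (hM₀ t k hk).trans ?_⟩
  have hL := log_height_pos t
  have hKk : (2 / 3 : ℝ) ^ K t ≤ (2 / 3) ^ k := pow_le_pow_of_le_one (by norm_num) (by norm_num) hkK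
  have hone : (2 / 3 : ℝ) ^ K t * (3 / 2) ^ K t = 1 := by rw [← mul_pow]; norm_num
  have hM : M₀ ≤ max M₀ 0 := le_max_left _ _
  have hM0 : 0 ≤ max M₀ 0 := le_max_right _ _
  calc M₀ ≤ max M₀ 0 * 1 := by linarith
    _ = max M₀ 0 * ((2 / 3 : ℝ) ^ K t * (3 / 2) ^ K t) := by rw [hone]
    _ ≤ max M₀ 0 * ((2 / 3 : ℝ) ^ K t * (B * Real.log (|t| + 3))) := by gcongr; exact hK t
    _ ≤ max M₀ 0 * ((2 / 3 : ℝ) ^ k * (B * Real.log (|t| + 3))) := by gcongr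
    _ = thr (2 / 3) (max M₀ 0 * B) t k := by unfold thr; ring

/-- So the `k`-split at such a cut-off is `X ⟸ (theorem) ∧ (piece ≡ RH)`: -/
theorem turanCriterion_iff_tail_of_pow_le {B : ℝ} (K : ℝ → ℕ)
    (hK : ∀ t, (3 / 2 : ℝ) ^ K t ≤ B * Real.log (|t| + 3)) : TuranCriterion ↔ Tail K :=
  ⟨restrict_of_turanCriterion _, turanCriterion_of_head_tail K (head_of_pow_le K hK)⟩

end TrivialRegime

/-! ### §I The isolation / conditional-head split (card `isolation-hypothesis-ioz`; route header
"NOT DECOMPOSED YET": `IsolationHypothesis → [RH ⟺ finitely many prime-sum inequalities per (δ,T)]`) -/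

section Isolation

/-- `ν_δ(t)`: the route's local off-line cluster count (the window used by `LocalDetection`). -/
def clusterCount (δ t : ℝ) : ℝ :=
  (zetaZeroCountRe (1 / 2 + δ / 2) (|t| + 2) : ℝ) - zetaZeroCountRe (1 / 2 + δ / 2) (|t| - 2)

/-- The detection range of `LocalDetection` at height `t` (with `T = max 3 |t|`). -/
def detectRange (A δ C t : ℝ) : ℝ :=
  A * (1 + clusterCount δ t) *
    (Real.log (Real.log (max 3 |t|)) + Real.log C + Real.log (1 / δ) + 1) / δ

/-- IOZ — the isolation hypothesis: off-line zeros never cluster (`ν_δ` bounded in `t`).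
RH-implied (`ν ≡ 0`), believed strictly weaker (card isolation-hypothesis-ioz: RH ⇒ IOZ ⇒ LH). -/
def IOZ : Prop := ∀ δ : ℝ, 0 < δ → δ < 1 / 2 → ∃ B : ℝ, ∀ t : ℝ, clusterCount δ t ≤ B

/-- POLYLOG HEAD (the card's `PolylogTuránCriterion`): given a cluster bound `B` at offset `δ`, ONE
constant `C ≥ 1` for which the crux bound holds on the range `k ≤ A(1+B)(log log|t| + log C + log δ⁻¹ + 1)/δ`
— prime sums of length `(δ⁻¹ log|t|)^{O((1+B)/δ)}`. -/
def PolylogHead : Prop := ∀ (A δ B : ℝ), 0 < δ → δ < 1 / 2 →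
  ∃ C : ℝ, 1 ≤ C ∧ ∀ (t : ℝ) (k : ℕ), 1 ≤ k →
    (k : ℝ) ≤ A * (1 + B) * (Real.log (Real.log (max 3 |t|)) + Real.log C + Real.log (1 / δ) + 1) / δ →
    ‖turanCoeff t k‖ ≤ C * (2 / 3) ^ k * Real.log (|t| + 3)

/-- CONDITIONAL HEAD (ν-form, no isolation needed to state it): for every offset `δ` and range
constant `A`, ONE constant `C ≥ 1` such that the crux bound holds on the ν-dependent detection range.
`X → CondHead` trivially; `CondHead ∧ LocalDetection → RH` (below); so CondHead is RH the day the
provable supports 2532 (`LocalDetection`) and 2535 (`CriterionOfRH`) land. -/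
def CondHead : Prop := ∀ (A δ : ℝ), 0 < δ → δ < 1 / 2 →
  ∃ C : ℝ, 1 ≤ C ∧ ∀ (t : ℝ) (k : ℕ), 1 ≤ k → (k : ℝ) ≤ detectRange A δ C t →
    ‖turanCoeff t k‖ ≤ C * (2 / 3) ^ k * Real.log (|t| + 3)

/-- `LocalDetection` read through `turanCoeff` / `clusterCount` (definitional). -/
theorem localDetection_iff : LocalDetection ↔ ∃ A : ℝ, ∀ (C δ T : ℝ) (ρ : ℂ), 1 ≤ C → 0 < δ →
    δ ≤ 1 / 2 → 3 ≤ T → riemannZeta ρ = 0 → 1 / 2 + δ ≤ ρ.re → |ρ.im| ≤ T → ∃ k : ℕ, 1 ≤ k ∧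
      (k : ℝ) ≤ A * (1 + clusterCount δ ρ.im) *
        (Real.log (Real.log T) + Real.log C + Real.log (1 / δ) + 1) / δ ∧
      C * (2 / 3 : ℝ) ^ k * Real.log (T + 3) < ‖turanCoeff ρ.im k‖ :=
  Iff.rfl

/-- Assembly of the conditional-head split through the PROVABLE support `LocalDetection` (2532):
`CondHead ∧ LocalDetection → quasi-RH(1/2)` — the route's `closes`, Step A, with `X` weakened to
`CondHead`. -/
theorem quasiRH_of_condHead (hH : CondHead) (hD : LocalDetection) :
    QuasiRiemannHypothesis (1 / 2) := by
  obtain ⟨A, hA⟩ := hD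
  intro s hs hlt h1
  set δ : ℝ := s.re - 1 / 2 with hδ
  have hδ0 : 0 < δ := by rw [hδ]; linarith
  have hδ1 : δ < 1 / 2 := by rw [hδ]; linarith
  obtain ⟨C, hC1, hC⟩ := hH A δ hδ0 hδ1
  obtain ⟨k, hk1, hkr, hk⟩ := hA C δ (max 3 |s.im|) s hC1 hδ0 hδ1.le (le_max_left _ _) hs
    (by rw [hδ]; linarith) (le_max_right _ _)
  have hb := hC s.im k hk1 hkr
  have hk' : C * (2 / 3 : ℝ) ^ k * Real.log (max 3 |s.im| + 3) < ‖turanCoeff s.im k‖ := hk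
  have hlog : Real.log (|s.im| + 3) ≤ Real.log (max 3 |s.im| + 3) :=
    Real.log_le_log (by linarith [abs_nonneg s.im]) (by linarith [le_max_right 3 |s.im|])
  have : C * (2 / 3 : ℝ) ^ k * Real.log (|s.im| + 3) ≤ C * (2 / 3 : ℝ) ^ k * Real.log (max 3 |s.im| + 3) :=
    mul_le_mul_of_nonneg_left hlog (mul_nonneg (by linarith) (by positivity))
  linarith

theorem riemannHypothesis_of_condHead (hH : CondHead) (hD : LocalDetection) : RiemannHypothesis :=
  quasiRiemannHypothesis_one_half_iff_holds.1 (quasiRH_of_condHead hH hD)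

/-- The typed assembly `CondHead → LocalDetection → CriterionOfRH → X` (the last two are the route's
provable-now supports 2532, 2535). -/
theorem turanCriterion_of_condHead (hH : CondHead) (hD : LocalDetection) (hcal : CriterionOfRH) :
    TuranCriterion :=
  hcal (riemannHypothesis_of_condHead hH hD)

/-- … and `X → CondHead` is a triviality, so modulo 2532 + 2535 the piece `CondHead` IS `X`. -/
theorem condHead_of_turanCriterion (h : TuranCriterion) : CondHead := by
  obtain ⟨C, hC⟩ := h
  intro A δ _ _
  refine ⟨max C 1, le_max_right _ _, fun t k hk _ ↦ (hC t k hk).trans ?_⟩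
  exact mul_le_mul_of_nonneg_right (mul_le_mul_of_nonneg_right (le_max_left _ _) (by positivity))
    (log_height_pos t).le

theorem polylogHead_of_turanCriterion (h : TuranCriterion) : PolylogHead := by
  obtain ⟨C, hC⟩ := h
  intro A δ B _ _
  refine ⟨max C 1, le_max_right _ _, fun t k hk _ ↦ (hC t k hk).trans ?_⟩
  exact mul_le_mul_of_nonneg_right (mul_le_mul_of_nonneg_right (le_max_left _ _) (by positivity))
    (log_height_pos t).le

end Isolation

end Summit.RiemannHypothesis.RiemannHypothesis.Cruxes.TuranCriterion.StrategyCensus
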